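import Summits.RiemannHypothesis.RiemannHypothesis.Theorems.GroundBartaGroundBartaFloorBarta
import Summits.RiemannHypothesis.RiemannHypothesis.Theorems.GroundBartaPolarPerronFrobeniusLeakageNeg
import HarnessLib

/-!
# An edge-tolerant (ROBUST) Barta inequality for the full windowed Weil form
(route `RiemannHypothesis/GroundBarta`, crux `PolarPerronFrobenius` stmt-RiemannHypothesis-18390;
helper — the RH-free analysis behind a robust restatement of the crux; see `…RobustFloor`)

The rung's floor (`neg_groundBartaRate_le_weilGroundEnergy`, file `…GroundBartaFloorBarta`) needs a
ground state `u` that is real and `≥ 0` a.e. on `(-a, a)`.  Here the sign hypothesis is removed from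
the analysis: for a ground state `u` at `a > 0` with `Im u = 0` a.e. on `(-a, a)`, writing
`v = 𝟙_{(-a,a)} Re u = v⁺ - v⁻`, `Φ = weilThetaPhi`, `e = groundBartaRate`,

  `ε(a) ∫ vΦ ≥ -e(a) ∫ v⁺Φ - (Π_a ∫ v⁻ + Φ(a)(4√(∫ (v⁻)²) + 8 ∫ v⁻))`,
  `Π_a = 2 Σ' Λ(n) n^{-1/2} Φ(max a (log n − a))`       (`robustBarta_weilGroundEnergy_mul_ge`).

Proof = the rung's proof (outer cut-off `Φχ_η`, harmonic splitting, `L²`-limit along the minimising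
sequence, Cauchy–Schwarz at the window `a + η`, `η → 0⁺` by continuity of `ε`) with ONE change: the
leakage `W(v ⋆ κ̃_η)` is split as `W(v⁺ ⋆ κ̃_η) − W(v⁻ ⋆ κ̃_η)` (additivity of `W` on the exponential
class); the first piece is `≤ 2(∫v⁺cosh(t/2))ϖ_a ≤ e(a)∫v⁺Φ` (`stub_leakageSign`), the second is
`≥ -(Π_a ∫ v⁻ + Φ(a)(4√(∫(v⁻)²) + 8∫v⁻))` uniformly in `η` (`leakNeg_re_weilFunctional_ge`).
References: Bombieri 2000 §4; Barta 1937 via López-Gómez, doi:10.1142/8664 p.175.  RH-free.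
-/

set_option linter.dupNamespace false

noncomputable section

open Set MeasureTheory Filter Complex
open scoped Real Topology ComplexConjugate ArithmeticFunction.vonMangoldt

namespace Summit.RiemannHypothesis.RiemannHypothesis.Theorems.GroundBartaFloor

open Literature.NumberTheory.LFunctions Literature.Analysis.Calculus
open Summit.RiemannHypothesis.RiemannHypothesis.Theorems.GroundStatesConvergeToXi

/-! ## Small helpers -/

/-- Weighted-`L¹` data of an integrable real function vanishing off `[-a, a]` (rate `b`).
[folklore] -/
theorem robustBarta_weighted_data {a : ℝ} {w : ℝ → ℝ} (hwi : Integrable w)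
    (hws : ∀ t, t ∉ Icc (-a) a → w t = 0) (b : ℝ) :
    AEStronglyMeasurable (fun t => ((w t : ℝ) : ℂ)) volume ∧
      Integrable (fun t : ℝ => ‖((w t : ℝ) : ℂ)‖ * Real.exp (b * |t|)) := by
  have hwa : AEStronglyMeasurable (fun t => ((w t : ℝ) : ℂ)) volume :=
    hwi.ofReal.aestronglyMeasurable
  refine ⟨hwa, (hwi.norm.mul_const (Real.exp (|b| * a))).mono' (hwa.norm.mul (by fun_prop))
    (ae_of_all _ fun t => ?_)⟩
  rw [Real.norm_eq_abs, abs_of_nonneg (by positivity), Complex.norm_real]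
  by_cases ht : t ∈ Icc (-a) a
  · refine mul_le_mul_of_nonneg_left (Real.exp_le_exp.2 ?_) (norm_nonneg _)
    have h1 : |t| ≤ a := abs_le.2 ⟨ht.1, ht.2⟩
    calc b * |t| ≤ |b| * |t| := mul_le_mul_of_nonneg_right (le_abs_self b) (abs_nonneg t)
      _ ≤ |b| * a := mul_le_mul_of_nonneg_left h1 (abs_nonneg b)
  · rw [hws t ht]; simp

/-- Convolution is additive in the FIRST (integrable) argument against a bounded continuous
kernel: `(f - g) ⋆ k̃ = f ⋆ k̃ - g ⋆ k̃` pointwise. [folklore] -/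
theorem robustBarta_weilConv_sub_left {f g k : ℝ → ℂ} (hf : Integrable f) (hg : Integrable g)
    (hk : Continuous k) {B : ℝ} (hkB : ∀ x, ‖k x‖ ≤ B) :
    weilConv (fun t => f t - g t) (weilReflect k) =
      fun t => weilConv f (weilReflect k) t - weilConv g (weilReflect k) t := by
  funext t
  have hc : Continuous fun u : ℝ => weilReflect k (t - u) :=
    ((hk.comp continuous_neg).star).comp (continuous_const.sub continuous_id)
  have hb : ∀ u : ℝ, ‖weilReflect k (t - u)‖ ≤ B := fun u => by
    rw [show weilReflect k (t - u) = conj (k (-(t - u))) from rfl, Complex.norm_conj]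
    exact hkB _
  have hint : ∀ {F : ℝ → ℂ}, Integrable F →
      Integrable (fun u : ℝ => F u * weilReflect k (t - u)) := fun hF =>
    hF.mul_bdd hc.aestronglyMeasurable (ae_of_all _ hb)
  rw [weilConv_apply, weilConv_apply, weilConv_apply, ← integral_sub (hint hf) (hint hg)]
  refine integral_congr_ae (Eventually.of_forall fun u => ?_)
  simp only
  ring

/-! ## The robust Barta inequality at a window -/

/-- **Robust Barta inequality.**  For a window `a > 0` carrying a ground state `u` with `Im u = 0`
a.e. on `(-a, a)`, write `v = 𝟙_{(-a,a)} Re u`, `v⁺ = max(v,0)`, `v⁻ = max(-v,0)`.  Then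
`ε(a) ∫ vΦ ≥ -e(a) ∫ v⁺Φ - (Π_a ∫ v⁻ + Φ(a)(4√(∫ (v⁻)²) + 8 ∫ v⁻))`,
`Π_a = 2 Σ' Λ(n) n^{-1/2} Φ(max a (log n - a))`, `e = groundBartaRate`.
[cite: Bombieri2000Weil, §4 Lemma 1] -/
theorem robustBarta_weilGroundEnergy_mul_ge {a : ℝ} (ha : 0 < a) {u : ℝ → ℂ}
    (hu : IsWeilGroundState a u) (hreal : ∀ᵐ t : ℝ, t ∈ Ioo (-a) a → (u t).im = 0) :
    -(groundBartaRate a *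
          ((∫ t, max ((Ioo (-a) a).indicator (fun t => (u t).re) t) 0 * weilThetaPhi t)) +
        ((2 * ∑' n : ℕ, (Λ n : ℝ) / Real.sqrt n * weilThetaPhi (max a (Real.log n - a))) *
            (∫ t, max (-(Ioo (-a) a).indicator (fun t => (u t).re) t) 0) +
          weilThetaPhi a *
            (4 * Real.sqrt (∫ t, max (-(Ioo (-a) a).indicator (fun t => (u t).re) t) 0 ^ 2) +
              8 * (∫ t, max (-(Ioo (-a) a).indicator (fun t => (u t).re) t) 0)))) ≤
      weilGroundEnergy a * (∫ t, (Ioo (-a) a).indicator (fun t => (u t).re) t * weilThetaPhi t) := by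
  obtain ⟨hu2, g, hg, hQ, hL⟩ := id hu
  /- (0) the real representative `v` of `u` and its parts -/
  set v : ℝ → ℝ := (Ioo (-a) a).indicator fun t => (u t).re with hv
  set vp : ℝ → ℝ := fun t => max (v t) 0 with hvp
  set vm : ℝ → ℝ := fun t => max (-v t) 0 with hvm
  set PiA : ℝ := 2 * ∑' n : ℕ, (Λ n : ℝ) / Real.sqrt n * weilThetaPhi (max a (Real.log n - a))
    with hPiA
  set R : ℝ := PiA * (∫ t, vm t) + weilThetaPhi a * (4 * Real.sqrt (∫ t, vm t ^ 2) + 8 * ∫ t, vm t)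
    with hR
  show -(groundBartaRate a * (∫ t, vp t * weilThetaPhi t) + R) ≤
      weilGroundEnergy a * (∫ t, v t * weilThetaPhi t)
  have hvp0 : ∀ t, 0 ≤ vp t := fun t => le_max_right _ _
  have hvm0 : ∀ t, 0 ≤ vm t := fun t => le_max_right _ _
  have hvs' : ∀ t, t ∉ Ioo (-a) a → v t = 0 := fun t ht => by
    simp only [hv, indicator_of_notMem ht]
  have hvs : ∀ t, t ∉ Icc (-a) a → v t = 0 := fun t ht =>
    hvs' t fun h => ht (Ioo_subset_Icc_self h)
  have hvps : ∀ t, t ∉ Icc (-a) a → vp t = 0 := fun t ht => by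
    simp only [hvp, hvs t ht, max_self]
  have hvms : ∀ t, t ∉ Icc (-a) a → vm t = 0 := fun t ht => by
    simp only [hvm, hvs t ht, neg_zero, max_self]
  have hv_le : ∀ t, |v t| ≤ ‖u t‖ := fun t => by
    by_cases ht : t ∈ Ioo (-a) a
    · simp only [hv, indicator_of_mem ht]
      exact Complex.abs_re_le_norm _
    · simp only [hv, indicator_of_notMem ht, abs_zero]; exact norm_nonneg _
  have hvp_le : ∀ t, |vp t| ≤ ‖u t‖ := fun t => by
    rw [abs_of_nonneg (hvp0 t)]
    exact (max_le (le_abs_self _) (abs_nonneg _)).trans (hv_le t)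
  have hvm_le : ∀ t, |vm t| ≤ ‖u t‖ := fun t => by
    rw [abs_of_nonneg (hvm0 t)]
    exact (max_le (neg_le_abs _) (abs_nonneg _)).trans (hv_le t)
  have hvpm : ∀ t, v t = vp t - vm t := fun t => by
    simp only [hvp, hvm]; exact (max_zero_sub_max_neg_zero_eq_self (v t)).symm
  have hnull : (volume : Measure ℝ) {-a, a} = 0 := (Set.toFinite _).measure_zero volume
  have hae2 := measure_eq_zero_iff_ae_notMem.1 hnull
  have hIoo_of : ∀ t : ℝ, t ∉ ({-a, a} : Set ℝ) → t ∈ Icc (-a) a → t ∈ Ioo (-a) a := by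
    intro t ht hm
    simp only [mem_insert_iff, mem_singleton_iff, not_or] at ht
    exact ⟨lt_of_le_of_ne hm.1 (fun h => ht.1 h.symm), lt_of_le_of_ne hm.2 (fun h => ht.2 h)⟩
  have hae : u =ᵐ[volume] fun t => ((v t : ℝ) : ℂ) := by
    filter_upwards [hreal, hu.ae_eq_zero_of_notMem, hae2] with t h1 h2 h3
    by_cases ht : t ∈ Ioo (-a) a
    · have him := h1 ht
      simp only [hv, indicator_of_mem ht]
      exact Complex.ext (by simp) (by simp [him])
    · have hm : t ∉ Icc (-a) a := fun hm => ht (hIoo_of t h3 hm)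
      simp only [hv, indicator_of_notMem ht, h2 hm, Complex.ofReal_zero]
  have hv_meas : AEStronglyMeasurable v volume :=
    (Complex.continuous_re.comp_aestronglyMeasurable hu2.1).indicator measurableSet_Ioo
  have hvp_meas : AEStronglyMeasurable vp volume := hv_meas.sup aestronglyMeasurable_const
  have hvm_meas : AEStronglyMeasurable vm volume := hv_meas.neg.sup aestronglyMeasurable_const
  have hv_int : Integrable v :=
    Integrable.mono' hu.integrable.norm hv_meas (Eventually.of_forall fun t => by
      rw [Real.norm_eq_abs]; exact hv_le t)
  have hvp_int : Integrable vp :=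
    Integrable.mono' hu.integrable.norm hvp_meas (Eventually.of_forall fun t => by
      rw [Real.norm_eq_abs]; exact hvp_le t)
  have hvm_int : Integrable vm :=
    Integrable.mono' hu.integrable.norm hvm_meas (Eventually.of_forall fun t => by
      rw [Real.norm_eq_abs]; exact hvm_le t)
  have hvm_L2 : MemLp vm 2 :=
    MemLp.of_le hu2 hvm_meas (Eventually.of_forall fun t => by
      rw [Real.norm_eq_abs]; exact hvm_le t)
  set vc : ℝ → ℂ := fun t => ((v t : ℝ) : ℂ) with hvc
  set vpc : ℝ → ℂ := fun t => ((vp t : ℝ) : ℂ) with hvpc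
  set vmc : ℝ → ℂ := fun t => ((vm t : ℝ) : ℂ) with hvmc
  have hvc_eq : vc = fun t => vpc t - vmc t := by
    funext t; simp only [hvc, hvpc, hvmc, hvpm t, Complex.ofReal_sub]
  set p : ℝ := ∫ t, v t * weilThetaPhi t with hp
  set P : ℝ := ∫ t, vp t * weilThetaPhi t with hP
  set c : ℝ := ∫ t, vp t * Real.cosh (t / 2) with hc
  have hcosh_le : ∀ t ∈ Icc (-a) a, Real.cosh (t / 2) ≤ Real.cosh (a / 2) := fun t ht => by
    rw [Real.cosh_le_cosh, abs_div, abs_div, abs_two, abs_of_pos ha]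
    exact div_le_div_of_nonneg_right (abs_le.2 ⟨ht.1, ht.2⟩) zero_le_two
  have hvpΦ_int : Integrable fun t => vp t * weilThetaPhi t := by
    refine Integrable.mono' (hvp_int.norm.mul_const (weilThetaPhi 0))
      (hvp_meas.mul continuous_weilThetaPhi.aestronglyMeasurable)
      (Eventually.of_forall fun t => ?_)
    rw [Real.norm_eq_abs, abs_mul, Real.norm_eq_abs, abs_of_pos (weilThetaPhi_pos t)]
    exact mul_le_mul_of_nonneg_left (gbf_weilThetaPhi_le_zero_val t) (abs_nonneg _)
  have hvpc_int : Integrable fun t => vp t * Real.cosh (t / 2) := by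
    refine Integrable.mono' (hvp_int.norm.mul_const (Real.cosh (a / 2)))
      (hvp_meas.mul (by fun_prop : Continuous fun t : ℝ => Real.cosh (t / 2)).aestronglyMeasurable)
      (Eventually.of_forall fun t => ?_)
    rw [Real.norm_eq_abs, abs_mul, Real.norm_eq_abs, abs_of_pos (Real.cosh_pos _)]
    by_cases ht : t ∈ Icc (-a) a
    · exact mul_le_mul_of_nonneg_left (hcosh_le t ht) (abs_nonneg _)
    · rw [hvps t ht, abs_zero, zero_mul, zero_mul]
  have hcp : weilThetaPhi a * c ≤ Real.cosh (a / 2) * P := by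
    rw [hc, hP, ← integral_const_mul, ← integral_const_mul]
    refine integral_mono (hvpc_int.const_mul _) (hvpΦ_int.const_mul _) fun t => ?_
    dsimp only
    by_cases ht : t ∈ Icc (-a) a
    · have h1 : weilThetaPhi a ≤ weilThetaPhi t :=
        gbf_weilThetaPhi_le_of_abs_le (abs_le.2 ⟨ht.1, ht.2⟩)
      have h2 := hcosh_le t ht
      calc weilThetaPhi a * (vp t * Real.cosh (t / 2))
          = vp t * (weilThetaPhi a * Real.cosh (t / 2)) := by ring
        _ ≤ vp t * (weilThetaPhi t * Real.cosh (a / 2)) :=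
          mul_le_mul_of_nonneg_left (mul_le_mul h1 h2 (Real.cosh_pos _).le (weilThetaPhi_pos t).le)
            (hvp0 t)
        _ = Real.cosh (a / 2) * (vp t * weilThetaPhi t) := by ring
    · rw [hvps t ht]; simp
  /- (1) the inequality at the larger window `a + η`, `0 < η ≤ 1` -/
  obtain ⟨C, hC⟩ := stub_cutoffEnergyBound a ha
  set E : ℝ := |weilGroundEnergy a| + |weilGroundEnergy (a + 1)| with hE
  set C' : ℝ := max C 0 + E * (2 * (a + 1) * weilThetaPhi 0 ^ 2) with hC'
  have hE0 : 0 ≤ E := by positivity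
  have hC'0 : 0 ≤ C' := by positivity
  have step : ∀ η : ℝ, 0 < η → η ≤ 1 →
      -(2 * c * groundThetaPolarWeight a + R) -
          Real.sqrt (weilGroundEnergy a - weilGroundEnergy (a + η)) * Real.sqrt C' ≤
        weilGroundEnergy (a + η) * p := by
    intro η hη hη1
    set b : ℝ := a + η with hb
    have hb0 : 0 < b := by positivity
    set χ : ℝ → ℝ := fun x => cutoff (a / η + 1) (x / η) with hχ
    set k : ℝ → ℂ := fun t => ((weilThetaPhi t * cutoff (a / η + 1) (t / η) : ℝ) : ℂ) with hk_def
    set κ : ℝ → ℂ := fun t => ((weilThetaPhi t * (1 - χ t) : ℝ) : ℂ) with hκ_def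
    have hχc : ContDiff ℝ (⊤ : ℕ∞) χ := gbf_contDiff_cutoff
    have hχs : HasCompactSupport χ := gbf_hasCompactSupport_cutoff hη
    have hχ1 : ∀ t ∈ Icc (-a) a, χ t = 1 := fun t ht => gbf_cutoff_eq_one hη ht
    have hχ01 : ∀ t, 0 ≤ χ t ∧ χ t ≤ 1 := fun t => ⟨cutoff_nonneg _ _, cutoff_le_one _ _⟩
    have hχe : ∀ t, χ (-t) = χ t := fun t => gbf_cutoff_neg t
    obtain ⟨hk, hks1, hkbd⟩ := cutoffEnergy_test (a := a) hη hη1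
    have hks : tsupport k ⊆ Icc (-b) b := by
      refine closure_minimal (fun t ht => ?_) isClosed_Icc
      by_contra h
      apply ht
      have : cutoff (a / η + 1) (t / η) = 0 :=
        gbf_cutoff_eq_zero_of_not_mem hη fun h' => h (Ioo_subset_Icc_self h')
      simp [hk_def, this]
    have hk_sub : k = fun t => ((weilThetaPhi t : ℝ) : ℂ) - κ t := by
      funext t
      simp only [hk_def, hκ_def, hχ]
      push_cast
      ring
    have hk_mem : ∀ {t : ℝ}, t ∈ Icc (-a) a → k t = ((weilThetaPhi t : ℝ) : ℂ) := fun ht => by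
      simp [hk_def, gbf_cutoff_eq_one hη ht]
    have hgb : ∀ n, tsupport (g n) ⊆ Icc (-b) b := fun n =>
      (hg n).2.1.trans (Icc_subset_Icc (by linarith) (by linarith))
    -- the leakage kernel is in the exponential class, continuous and bounded
    obtain ⟨hκd, hκe⟩ := stub_leakageKernelEnvelope χ hχc hχs
    have hκB : ∀ x, ‖κ x‖ ≤ weilThetaPhi 0 := fun x => by
      simp only [hκ_def, Complex.norm_real, Real.norm_eq_abs,
        abs_of_nonneg (leakKer_nonneg hχ01 x)]
      exact (leakKer_le hχ01 x).trans (gbf_weilThetaPhi_le_zero_val x)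
    have hsplit : ∀ n, weilFunctional (weilConv (g n) (weilReflect k)) =
        -weilFunctional (weilConv (g n) (weilReflect κ)) := fun n => by
      rw [hk_sub]
      exact stub_harmonicSplit (g n) κ (hg n).1 hκd hκe
    have hlimW : Tendsto (fun n => weilFunctional (weilConv (g n) (weilReflect κ))) atTop
        (𝓝 (weilFunctional (weilConv u (weilReflect κ)))) :=
      stub_leakageTendsto a u g κ hu hg hL hκd hκe
    have hWu : weilFunctional (weilConv u (weilReflect κ)) =
        weilFunctional (weilConv vc (weilReflect κ)) := by
      rw [gbf_weilConv_congr_ae_left hae]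
    -- SPLIT of the leakage along `v = v⁺ - v⁻`
    obtain ⟨hvpa, hvpw⟩ := robustBarta_weighted_data hvp_int hvps 1
    obtain ⟨hvma, hvmw⟩ := robustBarta_weighted_data hvm_int hvms 1
    obtain ⟨hFc, hFb, -⟩ := stub_strongClass_pairing vpc κ 1 1 hvpa (by norm_num) hvpw hκd
      (by norm_num) le_rfl hκe
    obtain ⟨hGc, hGb, -⟩ := stub_strongClass_pairing vmc κ 1 1 hvma (by norm_num) hvmw hκd
      (by norm_num) le_rfl hκe
    have hvpi : Integrable vpc := hvp_int.ofReal
    have hvmi : Integrable vmc := hvm_int.ofReal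
    have hWsplit : weilFunctional (weilConv vc (weilReflect κ)) =
        weilFunctional (weilConv vpc (weilReflect κ)) -
          weilFunctional (weilConv vmc (weilReflect κ)) := by
      rw [hvc_eq, robustBarta_weilConv_sub_left hvpi hvmi hκd.continuous hκB,
        weilFunctional_sub_expClass hFc hGc (by norm_num : (1 : ℝ) / 2 < 1) hFb hGb]
    have hsignP : (weilFunctional (weilConv vpc (weilReflect κ))).re ≤
        2 * c * groundThetaPolarWeight a :=
      stub_leakageSign a vp χ ha hvp_int hvp0 hvps hχ1 hχ01 hχe hκd hκe
    have hsignM : -R ≤ (weilFunctional (weilConv vmc (weilReflect κ))).re :=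
      leakNeg_re_weilFunctional_ge a vm χ ha hvm_int hvm_L2 hvm0 hvms hχ1 hχ01 hκd hκe
    have hsignW : (weilFunctional (weilConv vc (weilReflect κ))).re ≤
        2 * c * groundThetaPolarWeight a + R := by
      rw [hWsplit, Complex.sub_re]; linarith
    -- the pairing `⟨gₙ, k⟩ → ⟨u, k⟩ = p`
    have hlimP : Tendsto (fun n => ∫ t, g n t * conj (k t)) atTop (𝓝 (∫ t, u t * conj (k t))) :=
      ConnesVanSuijlekom.tendsto_integral_mul_conj_left (ConnesVanSuijlekom.isWeilTest_memLp hk) hu2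
        (fun n => ConnesVanSuijlekom.isWeilTest_memLp (hg n).1) hL
    have hPu : (∫ t, u t * conj (k t)).re = p := by
      have h1 : ∫ t, u t * conj (k t) = ∫ t, ((v t * weilThetaPhi t : ℝ) : ℂ) := by
        refine integral_congr_ae (hae.mono fun t ht => ?_)
        simp only [ht, hvc]
        by_cases hm : t ∈ Icc (-a) a
        · rw [hk_mem hm, Complex.conj_ofReal]; push_cast; ring
        · rw [hvs t hm]; simp
      rw [h1, integral_complex_ofReal, Complex.ofReal_re]
    -- `q_b(gₙ) → ε(a) - ε(b)`
    have hlimQ : Tendsto (fun n => Real.sqrt ((weilQuadratic (g n)).re -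
        weilGroundEnergy b * ∫ x, ‖g n x‖ ^ 2)) atTop
        (𝓝 (Real.sqrt (weilGroundEnergy a - weilGroundEnergy b))) := by
      refine ((hQ.sub_const (weilGroundEnergy b)).sqrt).congr fun n => ?_
      rw [(hg n).2.2, mul_one]
    have hqk : (weilQuadratic k).re - weilGroundEnergy b * ∫ x, ‖k x‖ ^ 2 ≤ C' := by
      have h1 : (weilQuadratic k).re ≤ max C 0 := (hC η hη hη1).trans (le_max_left _ _)
      have hI0 : 0 ≤ ∫ x, ‖k x‖ ^ 2 := integral_nonneg fun _ => by positivity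
      have hI : ∫ x, ‖k x‖ ^ 2 ≤ 2 * (a + 1) * weilThetaPhi 0 ^ 2 := by
        have hzero : ∀ x, x ∉ Icc (-b) b → ‖k x‖ ^ 2 = 0 := fun x hx => by
          rw [image_eq_zero_of_notMem_tsupport fun h' => hx (hks h'), norm_zero]; ring
        rw [← setIntegral_eq_integral_of_forall_compl_eq_zero (s := Icc (-b) b)
          (fun x hx => hzero x hx)]
        have hbd : ∀ x ∈ Icc (-b) b, ‖‖k x‖ ^ 2‖ ≤ weilThetaPhi 0 ^ 2 := fun x _ => by
          rw [Real.norm_eq_abs, abs_of_nonneg (by positivity)]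
          exact pow_le_pow_left₀ (norm_nonneg _) (hkbd x) 2
        have h2 := norm_setIntegral_le_of_norm_le_const (μ := (volume : Measure ℝ))
          (measure_Icc_lt_top (a := -b) (b := b)) hbd
        rw [Real.volume_real_Icc_of_le (by linarith), show b - -b = 2 * b by ring] at h2
        have h3 : ∫ x in Icc (-b) b, ‖k x‖ ^ 2 ≤ weilThetaPhi 0 ^ 2 * (2 * b) :=
          (le_abs_self _).trans (by simpa [Real.norm_eq_abs] using h2)
        have h4 : weilThetaPhi 0 ^ 2 * (2 * b) ≤ 2 * (a + 1) * weilThetaPhi 0 ^ 2 := by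
          have : b ≤ a + 1 := by linarith
          nlinarith [sq_nonneg (weilThetaPhi 0)]
        exact h3.trans h4
      have hεb : |weilGroundEnergy b| ≤ E := by
        have hlo : weilGroundEnergy (a + 1) ≤ weilGroundEnergy b :=
          weilGroundEnergy_antitoneOn hb0 (show (0 : ℝ) < a + 1 by positivity) (by linarith)
        have hhi : weilGroundEnergy b ≤ weilGroundEnergy a :=
          weilGroundEnergy_antitoneOn ha hb0 (by linarith)
        rw [hE, abs_le]
        constructor
        · linarith [neg_abs_le (weilGroundEnergy (a + 1)), abs_nonneg (weilGroundEnergy a)]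
        · linarith [le_abs_self (weilGroundEnergy a), abs_nonneg (weilGroundEnergy (a + 1))]
      have h5 : -(weilGroundEnergy b * ∫ x, ‖k x‖ ^ 2) ≤ E * (2 * (a + 1) * weilThetaPhi 0 ^ 2) :=
        calc -(weilGroundEnergy b * ∫ x, ‖k x‖ ^ 2) ≤ |weilGroundEnergy b| * ∫ x, ‖k x‖ ^ 2 := by
              rw [← neg_mul]
              exact mul_le_mul_of_nonneg_right (neg_le_abs _) hI0
          _ ≤ E * (2 * (a + 1) * weilThetaPhi 0 ^ 2) := mul_le_mul hεb hI hI0 hE0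
      rw [hC']
      linarith
    have hn : ∀ n, (-(weilFunctional (weilConv (g n) (weilReflect κ)))).re -
        Real.sqrt ((weilQuadratic (g n)).re - weilGroundEnergy b * ∫ x, ‖g n x‖ ^ 2) *
          Real.sqrt C' ≤
        weilGroundEnergy b * (∫ t, g n t * conj (k t)).re := by
      intro n
      have h1 := gbf_re_weilFunctional_sub_sqrt_le (hg n).1 (hgb n) hk hks
      rw [hsplit n] at h1
      have h2 : Real.sqrt ((weilQuadratic (g n)).re - weilGroundEnergy b * ∫ x, ‖g n x‖ ^ 2) *
          Real.sqrt ((weilQuadratic k).re - weilGroundEnergy b * ∫ x, ‖k x‖ ^ 2) ≤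
          Real.sqrt ((weilQuadratic (g n)).re - weilGroundEnergy b * ∫ x, ‖g n x‖ ^ 2) *
            Real.sqrt C' :=
        mul_le_mul_of_nonneg_left (Real.sqrt_le_sqrt hqk) (Real.sqrt_nonneg _)
      linarith
    have hlim_lhs : Tendsto (fun n => (-(weilFunctional (weilConv (g n) (weilReflect κ)))).re -
        Real.sqrt ((weilQuadratic (g n)).re - weilGroundEnergy b * ∫ x, ‖g n x‖ ^ 2) *
          Real.sqrt C') atTop
        (𝓝 ((-(weilFunctional (weilConv u (weilReflect κ)))).re -
          Real.sqrt (weilGroundEnergy a - weilGroundEnergy b) * Real.sqrt C')) :=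
      ((Complex.continuous_re.tendsto _).comp hlimW.neg).sub (hlimQ.mul_const _)
    have hlim_rhs : Tendsto (fun n => weilGroundEnergy b * (∫ t, g n t * conj (k t)).re) atTop
        (𝓝 (weilGroundEnergy b * p)) := by
      rw [← hPu]
      exact ((Complex.continuous_re.tendsto _).comp hlimP).const_mul _
    have hlim := le_of_tendsto_of_tendsto' hlim_lhs hlim_rhs hn
    have h6 : (weilFunctional (weilConv u (weilReflect κ))).re ≤
        2 * c * groundThetaPolarWeight a + R := by
      rw [hWu]; exact hsignW
    have h7 : (-(weilFunctional (weilConv u (weilReflect κ)))).re =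
        -(weilFunctional (weilConv u (weilReflect κ))).re := Complex.neg_re _
    linarith
  /- (2) `η → 0⁺` through the continuity of `ε` -/
  have hη : ∀ m : ℕ, 0 < 1 / ((m : ℝ) + 1) ∧ 1 / ((m : ℝ) + 1) ≤ 1 := fun m =>
    ⟨by positivity, by rw [div_le_one (by positivity)]; linarith [(Nat.cast_nonneg m : (0 : ℝ) ≤ m)]⟩
  have hten : Tendsto (fun m : ℕ => a + 1 / ((m : ℝ) + 1)) atTop (𝓝 a) := by
    have h := (tendsto_const_nhds (x := a) (f := (atTop : Filter ℕ))).add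
      tendsto_one_div_add_atTop_nhds_zero_nat
    rw [add_zero] at h
    exact h
  have hεlim : Tendsto (fun m : ℕ => weilGroundEnergy (a + 1 / ((m : ℝ) + 1))) atTop
      (𝓝 (weilGroundEnergy a)) :=
    (continuousAt_weilGroundEnergy ha).tendsto.comp hten
  have hΔlim : Tendsto (fun m : ℕ =>
      Real.sqrt (weilGroundEnergy a - weilGroundEnergy (a + 1 / ((m : ℝ) + 1))) * Real.sqrt C')
      atTop (𝓝 0) := by
    have h := (((tendsto_const_nhds (x := weilGroundEnergy a)).sub hεlim).sqrt).mul_const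
      (Real.sqrt C')
    simpa using h
  have hfinal : -(2 * c * groundThetaPolarWeight a + R) ≤ weilGroundEnergy a * p := by
    refine le_of_tendsto_of_tendsto' (b := atTop)
      (f := fun m : ℕ => -(2 * c * groundThetaPolarWeight a + R) -
        Real.sqrt (weilGroundEnergy a - weilGroundEnergy (a + 1 / ((m : ℝ) + 1))) * Real.sqrt C')
      (g := fun m : ℕ => weilGroundEnergy (a + 1 / ((m : ℝ) + 1)) * p) ?_ (hεlim.mul_const p)
      fun m => step _ (hη m).1 (hη m).2
    simpa using tendsto_const_nhds.sub hΔlim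
  /- (3) algebra: `2cϖ ≤ e(a) P` -/
  have hΦa := weilThetaPhi_pos a
  have hϖ := groundThetaPolarWeight_nonneg a
  have h1 : c ≤ Real.cosh (a / 2) * P / weilThetaPhi a := by
    rw [le_div_iff₀ hΦa]; linarith
  have h2 : 2 * c * groundThetaPolarWeight a ≤ groundBartaRate a * P := by
    have : 2 * c * groundThetaPolarWeight a ≤
        2 * (Real.cosh (a / 2) * P / weilThetaPhi a) * groundThetaPolarWeight a := by gcongr
    refine this.trans (le_of_eq ?_)
    unfold groundBartaRate
    field_simp
  linarith

end Summit.RiemannHypothesis.RiemannHypothesis.Theorems.GroundBartaFloor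

end
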